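import Mathlib
import HarnessLib
import Summits.HubbardSuperconductivity.HubbardSuperconductivity.Theorems.KLProgrammeKLRegimeEngineKernelMomentumLipschitz
import Summits.HubbardSuperconductivity.HubbardSuperconductivity.Theorems.KLProgrammeKLRegimeEngineFixedTupleNearFar

/-!
# Route `KLProgramme` — ENGINE item stmt-HubbardSuperconductivity-20437, class #6 / (E5-F)ₙ producer, route (M) of the (α-0) memo:
# the NEAR term read with the sup of the MULTIPLIED momentum kernel `T = (∏_i F_{ω_i})·K`, and that sup on a whole sector box from ONE
# reference value plus the first moments (assembly bricks for M3; model-free, instances on `𝒱ₙ[K]` / `klQuarticValue`)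

Cell gate-hubbard-kl, seat hubbard-kl-k3c2-p2 (g11; owner-designate of M1 + M3 of route (M), pen (R59az)).  Reading of record for M3 (KL STATUS, this seat,
2026-08-27 ≈21:5xZ): the position kernel is `W_Ω(x) = Σ_k T(k)·(phases)` with `T(k) = (∏_i F_{ω_i}(k_i))·K(k)`, so the near part of
`fixedTupleL1_le_near_add_far` only needs `sup_k |T(k)|` over CONSERVING strings `k` in the multipliers' supports, times the number of free-leg strings in the
supports — and `sup |T|` (unlike `sup |K|`) is exactly what the moment-Lipschitz theorem `pow_mul_norm_prodKernel_sub_le_moments` controls from one reference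
string.  Choosing the reference with the SAME spatial momenta and the frequencies moved to the (E5-F) reference pattern `(ω₀, ω₀, −ω₀, −ω₀)` keeps it on the
conservation surface with zero spatial dual distance, so neither a fattened-family plateau nor any sector-cell geometry enters.  This file:

* §1 `sum_norm_prodKernel_le_card_mul_sup`, **`norm_sectorisedKernel_le_card_supp_mul_supT`** — for a frequency- and momentum-conserving `G`:
  `‖W_Ω(x)‖ ≤ (∏_{j ≥ 1} #supp F_{ω_j})·S` whenever `|T(k)| ≤ S` for every string `k` in the supports (the leg-`0` momentum is slaved by conservation:
  `card_filter_kernel_cons_ne_zero_le_one`); hence **`fixedTupleL1_le_near_supT_add_far`**: `fixedTupleL1 β m W Ω x₁ ≤ ε^m·N_R^m·(∏_{j≥1} #supp F_{ω_j})·S + m·Mom/R`;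
* §2 **the sup from one reference value**: for `k`, `k⋆` conserving, `‖F‖ ≤ 1`, pin `x₁`, and `δ` bounding the free legs' dual distances,
  `(βL²)^m·|T(k)| ≤ (βL²)^m·‖K(k⋆)‖ + δ·Σ_j Mom_j(x₁)` (`pow_mul_norm_prodKernel_le_ref_add_moments`); with a FREQUENCY-ONLY reference `k⋆_i = (ι_i, k⃗_i)`
  (any conserving reference frequencies `ι`) the dual distances are `|ω_{k_j} − ω_{ι_j}|` alone (`pow_mul_norm_prodKernel_le_freqRef_add_moments`, `klTorusNorm_zero`);
* §3 **instances on `𝒱ₙ[K]`** with the (E5-F) reference pattern: for a BGM-ordered label tuple `Ω` (charges `(+,−,+,−)`, spins `(σ,σ,σ′,σ′)`) and a conserving string `k` in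
  ANY multiplier family, **`pow_mul_norm_prodKernel_klEffectiveAction_le_quarticValue_add_moments`**:
  `(βL²)³·|T(k)| ≤ ‖klQuarticValue … K n σ σ′ k⃗₀ k⃗₁ k⃗₂‖/24 + δ·Σ_{j<3} Mom_j(x₁)` whenever `|ω_{k_1} − ω₀|, |ω_{k_2} + ω₀|, |ω_{k_3} + ω₀| ≤ δ`
  (`vertexFn = 4!·(βL²)³·kernel`; the fourth momentum is `k⃗₀ − k⃗₁ + k⃗₂` by conservation) — the (E5-F)ₙ value hypothesis at `(σ,σ′) = (0,1)` feeds it verbatim.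

Left to M1/M2/M3 proper (T+): the near count `N_R` and the support counts `#supp F̄_{m,ω}` (calibration `O(ρ⁹)`), the (E4-iso)ₙ moments `Mom_j`, the frequency window
`|ω| < Λ_m` of the iso box against `ω₀ = π/β` (`δ ≤ Λ_m + π/β`, `support_klIsoFamily`), and the spin patterns other than `(σ,σ′)`, `σ ≠ σ′` (M4 (i)).
Everything is proved; no definitions; nothing about the model is asserted beyond these implications.
References: BGM 2006 §2.4 (2.52), §2.7 (2.70)–(2.71a), §3 (3.2) [cite: BenfattoGiulianiMastropietro2006].
-/

noncomputable section

namespace Summit.HubbardSuperconductivity.HubbardSuperconductivity.Theorems.EngineV8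

set_option linter.dupNamespace false -- summit = problem name (single-conjunct summit), D-0017

open Classical
open Real Finset Complex Literature.MathematicalPhysics.QuantumLattice Literature.Probability.LatticeModels GrassmannAlgebra
open Summit.HubbardSuperconductivity.HubbardSuperconductivity.Theorems.KLProgrammeLegKernels
open Summit.HubbardSuperconductivity.HubbardSuperconductivity.Theorems.KLRegimeSplit
open scoped ComplexConjugate

open Summit.HubbardSuperconductivity.HubbardSuperconductivity.Theorems.KLRegimeWick

variable {L M : ℕ} [NeZero L] [NeZero M]

/-! ## §1 The near term with the sup of the multiplied kernel `T = (∏F)·K` -/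

section Near

omit [NeZero M] in
/-- **`Σ_k |T(k)| ≤ (∏_{j ≥ 1} #supp F_{ω_j})·S`** for a frequency- and momentum-conserving `G`: for each string of free-leg momenta in the supports at most ONE
leg-`0` momentum carries a nonzero kernel, and there `|T| ≤ S`; off the supports `T = 0`. -/
theorem sum_norm_prodKernel_le_card_mul_sup {N m : ℕ} (F : Fin N → FreqMomentum L M → ℂ) (G : HubbardGrassmann L M)
    (hfreq : ∀ (m : ℕ) (X : Fin m → HubbardFieldIdx L M),
      (∑ i, (if (X i).2 = 0 then (1 : ℤ) else -1) * matsubaraInt M (X i).1.1.1) ≠ 0 → kernel ℂ G m X = 0)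
    (hmom : ∀ (m : ℕ) (X : Fin m → HubbardFieldIdx L M), (∑ i, signedMomentum L (X i).2 (X i).1.1.2) ≠ 0 → kernel ℂ G m X = 0)
    (Ω : Fin (m + 1) → SectorLeg N) {S : ℝ} (hS0 : 0 ≤ S)
    (hS : ∀ k : Fin (m + 1) → FreqMomentum L M, (∀ i, F (Ω i).1.1 (k i) ≠ 0) →
      ‖(∏ i, F (Ω i).1.1 (k i)) * kernel ℂ G (m + 1) (fun i => ((k i, (Ω i).1.2), (Ω i).2))‖ ≤ S) :
    ∑ k : Fin (m + 1) → FreqMomentum L M, ‖(∏ i, F (Ω i).1.1 (k i)) * kernel ℂ G (m + 1) (fun i => ((k i, (Ω i).1.2), (Ω i).2))‖ ≤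
      (∏ j : Fin m, (((univ : Finset (FreqMomentum L M)).filter fun q => F (Ω j.succ).1.1 q ≠ 0).card : ℝ)) * S := by
  set T : (Fin (m + 1) → FreqMomentum L M) → ℝ := fun k =>
    ‖(∏ i, F (Ω i).1.1 (k i)) * kernel ℂ G (m + 1) (fun i => ((k i, (Ω i).1.2), (Ω i).2))‖ with hT
  -- split the string as (leg-0 momentum, free momenta)
  have hsplit : ∑ k : Fin (m + 1) → FreqMomentum L M, T k = ∑ k' : Fin m → FreqMomentum L M, ∑ k₀ : FreqMomentum L M, T (Matrix.vecCons k₀ k') := by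
    rw [← (Fin.consEquiv fun _ : Fin (m + 1) => FreqMomentum L M).sum_comp, Fintype.sum_prod_type, sum_comm]
    rfl
  show ∑ k : Fin (m + 1) → FreqMomentum L M, T k ≤ _
  rw [hsplit]
  -- the set of free strings inside the supports
  set P : Finset (Fin m → FreqMomentum L M) := Fintype.piFinset fun j : Fin m => (univ : Finset (FreqMomentum L M)).filter fun q => F (Ω j.succ).1.1 q ≠ 0 with hP
  have hPcard : (P.card : ℝ) = ∏ j : Fin m, (((univ : Finset (FreqMomentum L M)).filter fun q => F (Ω j.succ).1.1 q ≠ 0).card : ℝ) := by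
    rw [hP, Fintype.card_piFinset]; push_cast; rfl
  -- each inner sum is `≤ S` on `P` and `= 0` off `P`
  have hinner : ∀ k' : Fin m → FreqMomentum L M, ∑ k₀ : FreqMomentum L M, T (Matrix.vecCons k₀ k') ≤ if k' ∈ P then S else 0 := by
    intro k'
    by_cases hk' : k' ∈ P
    · rw [if_pos hk']
      have hfree : ∀ j : Fin m, F (Ω j.succ).1.1 (k' j) ≠ 0 := fun j => by
        have := Fintype.mem_piFinset.1 hk' j
        exact (mem_filter.1 this).2
      -- the nonzero terms sit on at most one `k₀`
      set Sset := (univ : Finset (FreqMomentum L M)).filter fun k₀ =>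
        kernel ℂ G (m + 1) (fun i => ((Matrix.vecCons k₀ k' i, (Ω i).1.2), (Ω i).2)) ≠ 0 with hSset
      have hcard : Sset.card ≤ 1 := card_filter_kernel_cons_ne_zero_le_one G hfreq hmom m Ω k'
      have hvan : ∀ k₀ ∈ (univ : Finset (FreqMomentum L M)), k₀ ∉ Sset → T (Matrix.vecCons k₀ k') = 0 := by
        intro k₀ _ hk₀
        have : kernel ℂ G (m + 1) (fun i => ((Matrix.vecCons k₀ k' i, (Ω i).1.2), (Ω i).2)) = 0 := by
          by_contra h; exact hk₀ (mem_filter.2 ⟨mem_univ _, h⟩)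
        simp only [hT, this, mul_zero, norm_zero]
      rw [← sum_subset (subset_univ Sset) hvan]
      have hterm : ∀ k₀ ∈ Sset, T (Matrix.vecCons k₀ k') ≤ S := by
        intro k₀ _
        by_cases h0 : F (Ω 0).1.1 k₀ = 0
        · have : (∏ i, F (Ω i).1.1 (Matrix.vecCons k₀ k' i)) = 0 := prod_eq_zero (mem_univ 0) (by simpa using h0)
          simp only [hT, this, zero_mul, norm_zero]; exact hS0
        · exact hS _ fun i => Fin.cases (by simpa using h0) (fun j => by simpa using hfree j) i
      calc ∑ k₀ ∈ Sset, T (Matrix.vecCons k₀ k') ≤ ∑ _k₀ ∈ Sset, S := sum_le_sum hterm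
        _ = Sset.card * S := by rw [sum_const, nsmul_eq_mul]
        _ ≤ 1 * S := mul_le_mul_of_nonneg_right (by exact_mod_cast hcard) hS0
        _ = S := one_mul S
    · rw [if_neg hk']
      -- some free leg is off its support: every term vanishes
      have hj : ∃ j : Fin m, F (Ω j.succ).1.1 (k' j) = 0 := by
        by_contra h
        push Not at h
        exact hk' (Fintype.mem_piFinset.2 fun j => mem_filter.2 ⟨mem_univ _, h j⟩)
      obtain ⟨j, hj⟩ := hj
      refine (sum_eq_zero fun k₀ _ => ?_).le
      have : (∏ i, F (Ω i).1.1 (Matrix.vecCons k₀ k' i)) = 0 := prod_eq_zero (mem_univ j.succ) (by simpa using hj)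
      simp only [hT, this, zero_mul, norm_zero]
  calc ∑ k' : Fin m → FreqMomentum L M, ∑ k₀ : FreqMomentum L M, T (Matrix.vecCons k₀ k')
      ≤ ∑ k' : Fin m → FreqMomentum L M, (if k' ∈ P then S else 0) := sum_le_sum fun k' _ => hinner k'
    _ = P.card * S := by rw [← sum_filter, filter_mem_eq_inter, univ_inter, sum_const, nsmul_eq_mul]
    _ = _ := by rw [hPcard]

omit [NeZero M] in
/-- **THE NEAR SUP WITH `T`**: `‖W_Ω(x)‖ ≤ (∏_{j ≥ 1} #supp F_{ω_j})·S` at every position, for a conserving `G` with `|T| ≤ S` on the supports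
(`W_Ω(x) = Σ_k T(k)·(unimodular phases)`). -/
theorem norm_sectorisedKernel_le_card_supp_mul_supT {N m : ℕ} (β : ℝ) (F : Fin N → FreqMomentum L M → ℂ) (G : HubbardGrassmann L M)
    (hfreq : ∀ (m : ℕ) (X : Fin m → HubbardFieldIdx L M),
      (∑ i, (if (X i).2 = 0 then (1 : ℤ) else -1) * matsubaraInt M (X i).1.1.1) ≠ 0 → kernel ℂ G m X = 0)
    (hmom : ∀ (m : ℕ) (X : Fin m → HubbardFieldIdx L M), (∑ i, signedMomentum L (X i).2 (X i).1.1.2) ≠ 0 → kernel ℂ G m X = 0)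
    (Ω : Fin (m + 1) → SectorLeg N) (x : Fin (m + 1) → SpaceTimeIdx L M) {S : ℝ} (hS0 : 0 ≤ S)
    (hS : ∀ k : Fin (m + 1) → FreqMomentum L M, (∀ i, F (Ω i).1.1 (k i) ≠ 0) →
      ‖(∏ i, F (Ω i).1.1 (k i)) * kernel ℂ G (m + 1) (fun i => ((k i, (Ω i).1.2), (Ω i).2))‖ ≤ S) :
    ‖sectorisedKernel L M β F G (m + 1) Ω x‖ ≤
      (∏ j : Fin m, (((univ : Finset (FreqMomentum L M)).filter fun q => F (Ω j.succ).1.1 q ≠ 0).card : ℝ)) * S := by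
  rw [sectorisedKernel_def]
  refine (norm_sum_le _ _).trans (le_trans (sum_le_sum fun k _ => ?_) (sum_norm_prodKernel_le_card_mul_sup F G hfreq hmom Ω hS0 hS))
  -- `‖(∏ F·phase)·K‖ = ‖(∏F)·K‖`
  rw [norm_mul, norm_mul, norm_prod, norm_prod]
  refine le_of_eq ?_
  congr 1
  exact prod_congr rfl fun i _ => by rw [norm_mul, norm_hubbardPlaneWave, mul_one]

omit [NeZero M] in
/-- **NEAR/FAR WITH THE `T`-SUP**: `fixedTupleL1 β m W Ω x₁ ≤ ε^m·N_R^m·((∏_{j≥1} #supp F_{ω_j})·S) + m·Mom/R` for a conserving `G` with `|T| ≤ S` on the supports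
(`fixedTupleL1_le_near_add_far` with the `T`-sup). -/
theorem fixedTupleL1_le_near_supT_add_far {N m : ℕ} {β : ℝ} (hβ : 0 ≤ β) (F : Fin N → FreqMomentum L M → ℂ) (G : HubbardGrassmann L M)
    (hfreq : ∀ (m : ℕ) (X : Fin m → HubbardFieldIdx L M),
      (∑ i, (if (X i).2 = 0 then (1 : ℤ) else -1) * matsubaraInt M (X i).1.1.1) ≠ 0 → kernel ℂ G m X = 0)
    (hmom : ∀ (m : ℕ) (X : Fin m → HubbardFieldIdx L M), (∑ i, signedMomentum L (X i).2 (X i).1.1.2) ≠ 0 → kernel ℂ G m X = 0)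
    (Ω : Fin (m + 1) → SectorLeg N) (x₁ : SpaceTimeIdx L M) {R S Mom NR : ℝ} (hR : 0 < R) (hS0 : 0 ≤ S)
    (hS : ∀ k : Fin (m + 1) → FreqMomentum L M, (∀ i, F (Ω i).1.1 (k i) ≠ 0) →
      ‖(∏ i, F (Ω i).1.1 (k i)) * kernel ℂ G (m + 1) (fun i => ((k i, (Ω i).1.2), (Ω i).2))‖ ≤ S)
    (hMom : ∀ i : Fin m, imagTimeWeight β M ^ m *
      ∑ x : Fin m → SpaceTimeIdx L M, spaceTimeDist L M β x₁ (x i) * ‖sectorisedKernel L M β F G (m + 1) Ω (Matrix.vecCons x₁ x)‖ ≤ Mom)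
    (hN : ((((univ : Finset (SpaceTimeIdx L M)).filter fun y => spaceTimeDist L M β x₁ y < R).card : ℕ) : ℝ) ≤ NR) :
    fixedTupleL1 L M β m (sectorisedKernel L M β F G (m + 1)) Ω x₁ ≤
      imagTimeWeight β M ^ m * NR ^ m *
          ((∏ j : Fin m, (((univ : Finset (FreqMomentum L M)).filter fun q => F (Ω j.succ).1.1 q ≠ 0).card : ℝ)) * S) +
        m * Mom / R :=
  fixedTupleL1_le_near_add_far hβ (sectorisedKernel L M β F G (m + 1)) Ω x₁ hR
    (mul_nonneg (prod_nonneg fun _ _ => Nat.cast_nonneg _) hS0)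
    (fun x => norm_sectorisedKernel_le_card_supp_mul_supT β F G hfreq hmom Ω (Matrix.vecCons x₁ x) hS0 hS) hMom hN

end Near

/-! ## §2 The `T`-sup on a box from one reference value and the first moments -/

section Sup

/-- **`(βL²)^m·|T(k)| ≤ (βL²)^m·‖K(k⋆)‖ + δ·Σ_j Mom_j(x₁)`** for `k`, `k⋆` on the conservation surface, `‖F‖ ≤ 1` (so `|T(k⋆)| ≤ ‖K(k⋆)‖`), any pin `x₁`, and `δ` a
common bound of the free legs' dual distances (`pow_mul_norm_prodKernel_sub_le_moments` + the triangle inequality). -/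
theorem pow_mul_norm_prodKernel_le_ref_add_moments {N m : ℕ} {β : ℝ} (hβ : 0 < β) (F : Fin N → FreqMomentum L M → ℂ) (hF1 : ∀ ω q, ‖F ω q‖ ≤ 1)
    (G : HubbardGrassmann L M)
    (hfreq : ∀ (m : ℕ) (X : Fin m → HubbardFieldIdx L M),
      (∑ i, (if (X i).2 = 0 then (1 : ℤ) else -1) * matsubaraInt M (X i).1.1.1) ≠ 0 → kernel ℂ G m X = 0)
    (hmom : ∀ (m : ℕ) (X : Fin m → HubbardFieldIdx L M), (∑ i, signedMomentum L (X i).2 (X i).1.1.2) ≠ 0 → kernel ℂ G m X = 0)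
    (Ω : Fin (m + 1) → SectorLeg N) (k kr : Fin (m + 1) → FreqMomentum L M)
    (hf : ∑ i, (if (Ω i).2 = 0 then (1 : ℤ) else -1) * matsubaraInt M (k i).1 = 0) (hm : ∑ i, signedMomentum L (Ω i).2 (k i).2 = 0)
    (hfr : ∑ i, (if (Ω i).2 = 0 then (1 : ℤ) else -1) * matsubaraInt M (kr i).1 = 0) (hmr : ∑ i, signedMomentum L (Ω i).2 (kr i).2 = 0)
    (x₁ : SpaceTimeIdx L M) {δ : ℝ}
    (hδ : ∀ j : Fin m, |matsubaraFreq β M (k j.succ).1 - matsubaraFreq β M (kr j.succ).1| + 2 * klTorusNorm L ((k j.succ).2 - (kr j.succ).2) ≤ δ) :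
    (β * (L : ℝ) ^ 2) ^ m * ‖(∏ i, F (Ω i).1.1 (k i)) * kernel ℂ G (m + 1) (fun i => ((k i, (Ω i).1.2), (Ω i).2))‖ ≤
      (β * (L : ℝ) ^ 2) ^ m * ‖kernel ℂ G (m + 1) (fun i => ((kr i, (Ω i).1.2), (Ω i).2))‖ +
        δ * ∑ j : Fin m, imagTimeWeight β M ^ m *
          ∑ y : Fin m → SpaceTimeIdx L M, spaceTimeDist L M β x₁ (y j) * ‖sectorisedKernel L M β F G (m + 1) Ω (Matrix.vecCons x₁ y)‖ := by
  have hL := pow_mul_norm_prodKernel_sub_le_moments hβ F G hfreq hmom Ω k kr hf hm hfr hmr x₁ hδ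
  have hβL : 0 ≤ (β * (L : ℝ) ^ 2) ^ m := pow_nonneg (mul_nonneg hβ.le (sq_nonneg _)) m
  -- `|T(k⋆)| ≤ ‖K(k⋆)‖`
  have hTr : ‖(∏ i, F (Ω i).1.1 (kr i)) * kernel ℂ G (m + 1) (fun i => ((kr i, (Ω i).1.2), (Ω i).2))‖ ≤
      ‖kernel ℂ G (m + 1) (fun i => ((kr i, (Ω i).1.2), (Ω i).2))‖ := by
    rw [norm_mul, norm_prod]
    exact mul_le_of_le_one_left (norm_nonneg _) (prod_le_one (fun i _ => norm_nonneg _) fun i _ => hF1 _ _)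
  -- triangle inequality
  have htri : ‖(∏ i, F (Ω i).1.1 (k i)) * kernel ℂ G (m + 1) (fun i => ((k i, (Ω i).1.2), (Ω i).2))‖ ≤
      ‖(∏ i, F (Ω i).1.1 (kr i)) * kernel ℂ G (m + 1) (fun i => ((kr i, (Ω i).1.2), (Ω i).2))‖ +
        ‖(∏ i, F (Ω i).1.1 (k i)) * kernel ℂ G (m + 1) (fun i => ((k i, (Ω i).1.2), (Ω i).2)) -
          (∏ i, F (Ω i).1.1 (kr i)) * kernel ℂ G (m + 1) (fun i => ((kr i, (Ω i).1.2), (Ω i).2))‖ := norm_le_insert' _ _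
  calc (β * (L : ℝ) ^ 2) ^ m * ‖(∏ i, F (Ω i).1.1 (k i)) * kernel ℂ G (m + 1) (fun i => ((k i, (Ω i).1.2), (Ω i).2))‖
      ≤ (β * (L : ℝ) ^ 2) ^ m * ‖(∏ i, F (Ω i).1.1 (kr i)) * kernel ℂ G (m + 1) (fun i => ((kr i, (Ω i).1.2), (Ω i).2))‖ +
          (β * (L : ℝ) ^ 2) ^ m * ‖(∏ i, F (Ω i).1.1 (k i)) * kernel ℂ G (m + 1) (fun i => ((k i, (Ω i).1.2), (Ω i).2)) -
            (∏ i, F (Ω i).1.1 (kr i)) * kernel ℂ G (m + 1) (fun i => ((kr i, (Ω i).1.2), (Ω i).2))‖ := by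
        rw [← mul_add]; exact mul_le_mul_of_nonneg_left htri hβL
    _ ≤ _ := add_le_add (mul_le_mul_of_nonneg_left hTr hβL) hL

/-- **FREQUENCY-ONLY REFERENCE**: moving only the frequencies of a conserving string `k` to conserving reference indices `ι` (same spatial momenta) keeps the
string on the conservation surface and costs `δ ≥ |ω_{k_j} − ω_{ι_j}|` on the free legs (spatial dual distance `|0|_𝕋 = 0`):
`(βL²)^m·|T(k)| ≤ (βL²)^m·‖K((ι_i, k⃗_i)_i)‖ + δ·Σ_j Mom_j(x₁)`. -/
theorem pow_mul_norm_prodKernel_le_freqRef_add_moments {N m : ℕ} {β : ℝ} (hβ : 0 < β) (F : Fin N → FreqMomentum L M → ℂ) (hF1 : ∀ ω q, ‖F ω q‖ ≤ 1)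
    (G : HubbardGrassmann L M)
    (hfreq : ∀ (m : ℕ) (X : Fin m → HubbardFieldIdx L M),
      (∑ i, (if (X i).2 = 0 then (1 : ℤ) else -1) * matsubaraInt M (X i).1.1.1) ≠ 0 → kernel ℂ G m X = 0)
    (hmom : ∀ (m : ℕ) (X : Fin m → HubbardFieldIdx L M), (∑ i, signedMomentum L (X i).2 (X i).1.1.2) ≠ 0 → kernel ℂ G m X = 0)
    (Ω : Fin (m + 1) → SectorLeg N) (k : Fin (m + 1) → FreqMomentum L M) (ι : Fin (m + 1) → MatsubaraIdx M)
    (hf : ∑ i, (if (Ω i).2 = 0 then (1 : ℤ) else -1) * matsubaraInt M (k i).1 = 0) (hm : ∑ i, signedMomentum L (Ω i).2 (k i).2 = 0)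
    (hι : ∑ i, (if (Ω i).2 = 0 then (1 : ℤ) else -1) * matsubaraInt M (ι i) = 0)
    (x₁ : SpaceTimeIdx L M) {δ : ℝ} (hδ : ∀ j : Fin m, |matsubaraFreq β M (k j.succ).1 - matsubaraFreq β M (ι j.succ)| ≤ δ) :
    (β * (L : ℝ) ^ 2) ^ m * ‖(∏ i, F (Ω i).1.1 (k i)) * kernel ℂ G (m + 1) (fun i => ((k i, (Ω i).1.2), (Ω i).2))‖ ≤
      (β * (L : ℝ) ^ 2) ^ m * ‖kernel ℂ G (m + 1) (fun i => (((ι i, (k i).2), (Ω i).1.2), (Ω i).2))‖ +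
        δ * ∑ j : Fin m, imagTimeWeight β M ^ m *
          ∑ y : Fin m → SpaceTimeIdx L M, spaceTimeDist L M β x₁ (y j) * ‖sectorisedKernel L M β F G (m + 1) Ω (Matrix.vecCons x₁ y)‖ := by
  have h := pow_mul_norm_prodKernel_le_ref_add_moments hβ F hF1 G hfreq hmom Ω k (fun i => (ι i, (k i).2)) hf hm hι hm x₁
    (δ := δ) (fun j => by simpa [klTorusNorm_zero] using hδ j)
  exact h

end Sup

/-! ## §3 Instances on `𝒱ₙ[K]` with the (E5-F) reference pattern `(ω₀, ω₀, −ω₀, −ω₀)` -/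

section Model

omit [NeZero L] in
/-- The (E5-F) reference frequencies `(ω₀, ω₀, −ω₀, −ω₀)` are on the conservation surface of the BGM charge pattern `(+,−,+,−)`. -/
theorem bgm_refFreq_conserving {N : ℕ} (Ω : Fin 4 → SectorLeg N) (h0 : (Ω 0).2 = 0) (h1 : (Ω 1).2 = 1) (h2 : (Ω 2).2 = 0) (h3 : (Ω 3).2 = 1) :
    ∑ i, (if (Ω i).2 = 0 then (1 : ℤ) else -1) * matsubaraInt M (![omega0 M, omega0 M, (omega0 M).rev, (omega0 M).rev] i) = 0 := by
  simp [Fin.sum_univ_four, h0, h1, h2, h3, matsubaraInt_rev]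

omit [NeZero L] [NeZero M] in
/-- For the BGM charge pattern `(+,−,+,−)`, momentum conservation of a string `k` reads `k⃗₃ = k⃗₀ − k⃗₁ + k⃗₂`. -/
theorem bgm_fourth_momentum {N : ℕ} (Ω : Fin 4 → SectorLeg N) (h0 : (Ω 0).2 = 0) (h1 : (Ω 1).2 = 1) (h2 : (Ω 2).2 = 0) (h3 : (Ω 3).2 = 1)
    (k : Fin 4 → FreqMomentum L M) (hm : ∑ i, signedMomentum L (Ω i).2 (k i).2 = 0) :
    (k 3).2 = (k 0).2 - (k 1).2 + (k 2).2 := by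
  simp only [Fin.sum_univ_four, signedMomentum, h0, h1, h2, h3, if_true, show (1 : Fin 2) ≠ 0 by decide, if_false] at hm
  -- `k0 - k1 + k2 - k3 = 0`
  have : (k 0).2 + -(k 1).2 + (k 2).2 + -(k 3).2 = 0 := hm
  linear_combination (exp := 1) -this

/-- **THE `T`-SUP OF `𝒱ₙ[K]`'S QUARTIC KERNEL ON A BOX FROM THE (E5-F) VALUE** (`0 < β`; ANY multiplier family with `‖F‖ ≤ 1`; `Ω` BGM-ordered: charges
`(+,−,+,−)`, spins `(σ,σ,σ′,σ′)`; `k` a conserving string; pin `x₁`; `δ` with `|ω_{k_1} − ω₀|, |ω_{k_2} + ω₀|, |ω_{k_3} + ω₀| ≤ δ`):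
`(βL²)³·‖(∏_i F_{ω_i}(k_i))·K(k)‖ ≤ ‖klQuarticValue … K n σ σ′ k⃗₀ k⃗₁ k⃗₂‖/24 + δ·Σ_{j<3} ε³ Σ_y spaceTimeDist x₁ (y_j)·‖W_Ω(x₁ :: y)‖`. -/
theorem pow_mul_norm_prodKernel_klEffectiveAction_le_quarticValue_add_moments {N : ℕ} {β : ℝ} (hβ : 0 < β)
    (F : Fin N → FreqMomentum L M → ℂ) (hF1 : ∀ ω q, ‖F ω q‖ ≤ 1) (U μ : ℝ) (K : TrigPolyC4v) (n : ℕ)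
    (Ω : Fin 4 → SectorLeg N) (h0 : (Ω 0).2 = 0) (h1 : (Ω 1).2 = 1) (h2 : (Ω 2).2 = 0) (h3 : (Ω 3).2 = 1)
    {σ σ' : Fin 2} (hs0 : (Ω 0).1.2 = σ) (hs1 : (Ω 1).1.2 = σ) (hs2 : (Ω 2).1.2 = σ') (hs3 : (Ω 3).1.2 = σ')
    (k : Fin 4 → FreqMomentum L M)
    (hf : ∑ i, (if (Ω i).2 = 0 then (1 : ℤ) else -1) * matsubaraInt M (k i).1 = 0) (hm : ∑ i, signedMomentum L (Ω i).2 (k i).2 = 0)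
    (x₁ : SpaceTimeIdx L M) {δ : ℝ}
    (hδ1 : |matsubaraFreq β M (k 1).1 - matsubaraFreq β M (omega0 M)| ≤ δ)
    (hδ2 : |matsubaraFreq β M (k 2).1 - matsubaraFreq β M (omega0 M).rev| ≤ δ)
    (hδ3 : |matsubaraFreq β M (k 3).1 - matsubaraFreq β M (omega0 M).rev| ≤ δ) :
    (β * (L : ℝ) ^ 2) ^ 3 *
        ‖(∏ i, F (Ω i).1.1 (k i)) * kernel ℂ (klEffectiveAction L M β U μ K klE0 n) 4 (fun i => ((k i, (Ω i).1.2), (Ω i).2))‖ ≤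
      ‖klQuarticValue L M β U μ K n σ σ' (k 0).2 (k 1).2 (k 2).2‖ / 24 +
        δ * ∑ j : Fin 3, imagTimeWeight β M ^ 3 * ∑ y : Fin 3 → SpaceTimeIdx L M,
          spaceTimeDist L M β x₁ (y j) * ‖sectorisedKernel L M β F (klEffectiveAction L M β U μ K klE0 n) 4 Ω (Matrix.vecCons x₁ y)‖ := by
  set ι : Fin 4 → MatsubaraIdx M := ![omega0 M, omega0 M, (omega0 M).rev, (omega0 M).rev] with hιdef
  have hι := bgm_refFreq_conserving (M := M) Ω h0 h1 h2 h3
  have hδ : ∀ j : Fin 3, |matsubaraFreq β M (k j.succ).1 - matsubaraFreq β M (ι j.succ)| ≤ δ := by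
    intro j
    fin_cases j
    · simpa [hιdef] using hδ1
    · simpa [hιdef] using hδ2
    · simpa [hιdef] using hδ3
  have h := pow_mul_norm_prodKernel_le_freqRef_add_moments hβ F hF1 (klEffectiveAction L M β U μ K klE0 n)
    (fun _ _ hX => kernel_klEffectiveAction_eq_zero_of_freq β U μ K klE0 n hX)
    (fun m' X hX => klEffectiveAction_momentumConserving β U μ K klE0 n m' X hX) Ω k ι hf hm hι x₁ hδ
  -- the reference kernel is the (E5-F) value: `vertexFn = 4!·(βL²)³·kernel`
  have h4 := bgm_fourth_momentum Ω h0 h1 h2 h3 k hm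
  have hlab : (fun i : Fin 4 => (((ι i, (k i).2), (Ω i).1.2), (Ω i).2)) =
      ![(((omega0 M, (k 0).2), σ), 0), (((omega0 M, (k 1).2), σ), 1), ((((omega0 M).rev, (k 2).2), σ'), 0),
        ((((omega0 M).rev, (k 0).2 - (k 1).2 + (k 2).2), σ'), 1)] := by
    funext i
    fin_cases i
    · simp [hιdef, hs0, h0]
    · simp [hιdef, hs1, h1]
    · simp [hιdef, hs2, h2]
    · simp [hιdef, hs3, h3, h4]
  have hval : (β * (L : ℝ) ^ 2) ^ 3 * ‖kernel ℂ (klEffectiveAction L M β U μ K klE0 n) 4 (fun i => (((ι i, (k i).2), (Ω i).1.2), (Ω i).2))‖ =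
      ‖klQuarticValue L M β U μ K n σ σ' (k 0).2 (k 1).2 (k 2).2‖ / 24 := by
    rw [klQuarticValue, vertexFn_def, ← hlab, norm_mul, Complex.norm_real, Real.norm_eq_abs,
      abs_of_nonneg (mul_nonneg (Nat.cast_nonneg _) (pow_nonneg (mul_nonneg hβ.le (sq_nonneg _)) _))]
    norm_num [Nat.factorial]
    ring
  rw [hval] at h
  exact h

end Model

end Summit.HubbardSuperconductivity.HubbardSuperconductivity.Theorems.EngineV8

end
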